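import Mathlib.Analysis.Complex.Isometry
import Mathlib.Analysis.InnerProductSpace.PiL2
import Literature.MathematicalPhysics.StatisticalMechanics.Theil2006SimplexExpansion
import HarnessLib

/-!
# Theil 2006, Lemma 4.2: the rigidity estimate for a single simplex — bond-length deficits of
a triangle control the distance of its affine gradient (and of the inverse) from `SO(2)` — proof;
and the per-simplex form in which it is used in the proof of Proposition 4.3

Topic `Literature/MathematicalPhysics/StatisticalMechanics`; companion of `Theil2006.lean`
(F. Theil, *A proof of crystallization in two dimensions*, Comm. Math. Phys. **262** (2006)
209–236, read in the author's accepted preprint of 26 Aug 2005, same numbering, lit store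
`paper:url-69bff4ce1e30`), Appendix §4.1 *Geometric rigidity*, p. 17–18, and of
`Theil2006SimplexExpansion.lean` (`Theil2006.Plane`-valued `det₂`). Everything in this file is
PROVED (no `sorry`, no definition, no named fact; D-0026).

## Source, as printed (preprint p. 17)

"The following lemma links gradient estimates for continuous interpolations to the distortion of
simplices.

**Lemma 4.2.** There exist two universal constants `K, α₀ > 0` such that for each pair of triples
`y_i, η_i ∈ ℝ²`, `i = 0, 1, 2` with the properties
`det(y₁ − y₀, y₂ − y₀) det(η₁ − η₀, η₂ − η₀) ≥ 0`,
`||y_i − y_j| − 1| ≤ α₀` and `|η_i − η_j| = 1` if `i ≠ j`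
the inequalities
(50) `min_{R ∈ SO(2)} |F − R|² ≤ K max_{i≠j} ||y_i − y_j| − 1|²`,
(51) `min_{R ∈ SO(2)} |F⁻¹ − R|² ≤ K max_{i≠j} ||y_i − y_j| − 1|²`,
hold, where `|M| := √trace(MᵀM)` for a `2 × 2`-matrix `M`. The matrix `F ∈ ℝ^{2×2}` is the
gradient of the unique affine map `u : conv{η₀, η₁, η₂} → ℝ²` which satisfies `u(η_i) = y_i` for
`i = 0, 1, 2`."

Printed proof (p. 17–18): reduce to `η_i = Y₀ v_i`; with `G := FᵀF − Id` and
`m := max_i ||F η_i|² − 1|`, the three unit directions of the equilateral frame give `|G| ≤ C m`;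
"It is known that `l = |√(FᵀF) − Id|`"; `H := (√(FᵀF) + Id)⁻¹`, `|H| ≤ 2`, `l = |GH| ≤ Cm`;
(51) by the polar decomposition `F = RS`, `H := S − Id`, `|2H + H²| ≤ Cm`,
`F⁻¹ = (Id − H + H² − …)Rᵀ`. (Lemma 4.2 is the per-simplex input of Proposition 4.3, the `L²`
rigidity on a dilated simplex via Friesecke–James–Müller (53).)

## Rendering and what is proved

* `Theil2006.simplex_rigidity` — **Lemma 4.2, (50) and (51), PROVED in complex coordinates
  `ℝ² ≅ ℂ`** (as in `Theil2006LatticeCharacterization.lean`): points of `ℝ²` are complex numbers,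
  `det(z, w) = Re z · Im w − Im z · Re w`, the gradient of the affine interpolation is an
  `ℝ`-linear `F : ℂ →ₗ[ℝ] ℂ` with `F(η_i − η₀) = y_i − y₀` (the two edge vectors form a basis, so
  this IS the gradient of the unique affine `u` with `u(η_i) = y_i`), a rotation `R ∈ SO(2)` is
  `z ↦ r z` with `|r| = 1` (`LinearMap.mulLeft ℝ r`), `|M|² = trace(MᵀM)` is `‖M 1‖² + ‖M i‖²`
  (the matrix of `M` in the orthonormal basis `(1, i)`), and `F⁻¹` is an `ℝ`-linear two-sided
  inverse `G` of `F` (it exists under the hypotheses).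
* `Theil2006.simplex_rigidity_plane` — **the same on `Theil2006.Plane = EuclideanSpace ℝ (Fin 2)`**
  with the tree's `det₂`, rotations as linear isometry equivalences `R` of `ℝ²` with
  `LinearMap.det R = 1` (the convention of `Theil2006LatticeCharacterization.lean`), and the
  Frobenius norm through the standard basis `(1,0), (0,1)`; transported from the complex form
  along Mathlib's isometry `Complex.orthonormalBasisOneI.repr : ℂ ≃ₗᵢ[ℝ] ℝ²`
  (`Mathlib`'s `rotation`, `det_rotation`, `LinearMap.det_conj`).
* In both: a bound on `min_{R ∈ SO(2)}` is witnessed by an explicit rotation;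
  `max_{i≠j} ||y_i − y_j| − 1| ≤ α₀` enters as an arbitrary common bound `m ≤ α₀` of the three
  deficits (take `m` = the maximum to recover the printed form). Explicit constants `K = 500`,
  `α₀ = 1/48` ("we do not make any effort to optimize the constants", p. 4).
* `Theil2006.simplex_rigidity_sum` / `Theil2006.simplex_rigidity_sum_plane` — the form in which
  (50) is USED, the first display in the proof of Proposition 4.3 (p. 18): "By Lemma 4.2 for each
  triple `{x₁,x₂,x₃} ⊂ A₂` with the property `|x_i − x_j| = 1` if `i ≠ j` and each
  `x ∈ int(conv{x₁,x₂,x₃})` we have that `dist(∇u(x), SO(2)) ≤ K Σ_{i≠j} ||u(x_i) − u(x_j)| − 1|²`"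
  — for `u` affine on the simplex (`∇u = F`), PROVED in the form
  `dist² ≤ K · ((|y₁−y₀|−1)² + (|y₂−y₀|−1)² + (|y₂−y₁|−1)²)` WITHOUT the smallness hypothesis of
  Lemma 4.2 (a deficit `> α₀` makes the trivial bound `|F − Id|² ≤ 4(1 + max deficit)² + 4`
  already `≤ K' max deficit²`) but WITH its orientation hypothesis. **Two print flags** (details
  in the docstring of `simplex_rigidity_sum`): (1) the display is printed with `dist` unsquared on
  the left; the squared form is what Lemma 4.2 gives and what (53) consumes, and the unsquared
  form fails for `F = (1 + δ) Id` (deficits `δ`, `dist = √2 δ`); (2) the display is quoted without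
  the hypotheses of Lemma 4.2: smallness is removable (this theorem), orientation is NOT —
* `Theil2006.frob_sq_conj_sub_rotation` — the reflection `z ↦ z̄` interpolates the reflected
  triple, preserves every edge length, and has `|F − R|² = 4` for every rotation `R` (our remark;
  in the paper the maps to which Lemma 4.2 / Proposition 4.3 are applied interpolate the
  configuration against a discrete imbedding — `u = y ∘ Φ_T⁻¹` on a dilated lattice simplex,
  pp. 10–11; `u(y(x)) = Φ(x)`, p. 23 — and discrete imbeddings are orientation preserving by
  Definition 2.4 (20), which is precisely the hypothesis `det · det ≥ 0`; so we keep it).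

Our proof replaces the polar-decomposition argument (whose "it is known that
`l = |√(FᵀF) − Id|`" silently uses `det F > 0`, supplied by the orientation hypothesis) by the
normal form `F z = p z + q z̄` of an `ℝ`-linear map of `ℂ` (`p = (F1 − iFi)/2`, `q = (F1 + iFi)/2`):
`det F = |p|² − |q|²`, `|F − (z ↦ rz)|² = 2|p − r|² + 2|q|²`, so for `|q| ≤ |p|` the squared
distance to `SO(2)` is `2(|p| − 1)² + 2|q|²` at `r = p/|p|`; along the equilateral frame
`e₂ = t e₁` (`|t| = 1`, `Re t = ½`, `t² = t − 1`) the three squared edge deficits are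
`s + 2 Re w`, `s + 2 Re((t − 1) w)`, `s − 2 Re(t w)` with `s = |p|² + |q|² − 1`, `w = (p e₁)(q ē₁)‾`,
whence `|s| ≤ 3m`, `|p|²|q|² = |w|² ≤ 36 m²`; the orientation hypothesis gives `|q| ≤ |p|`, hence
`|q|² ≤ 45 m²`, `||p|² − 1| ≤ 6m`; and `F⁻¹ z = (p̄ z − q z̄)/(|p|² − |q|²)` is treated the same way
with `r' = p̄/|p|`; for the sum form, `|Fe₁|² + |Fe₂|² + |F(e₂ − e₁)|² = 3(|p|² + |q|²)` along
the frame (the cross terms cancel: `e₁² + e₂² + (e₂ − e₁)² = 0`). Heartbeat hygiene: each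
arithmetic step is a separate private lemma.
[cite: Theil2006, §4.1 Lemma 4.2 (50)–(51) and proof of Prop. 4.3, first display (preprint pp. 17–18)]
* `Theil2006.simplex_bilipschitz_plane` — **Lemma 4.2 as a bi-Lipschitz estimate**: under
  the hypotheses of Lemma 4.2, `(1 − K m)|w| ≤ |F w| ≤ (1 + K m)|w|` for all `w ∈ ℝ²`
  (`K = √K₄.₂`; from (50) by Cauchy–Schwarz) — the form in which Lemma 4.2 enters the proof of
  Proposition 4.8 (61) on p. 23 ("by Lemma 4.2 `‖∇u − SO(2)‖_{L∞(Ω₂)} ≤ Kα`").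
-/

noncomputable section

open Complex ComplexConjugate

namespace Literature.MathematicalPhysics.StatisticalMechanics

namespace Theil2006

/-! ### ℝ-linear maps of `ℂ ≅ ℝ²`: `F z = p z + q z̄` -/

/-- An `ℝ`-linear map of `ℂ` commutes with real scalars written as products. [folklore] -/
private theorem map_ofReal_mul (F : ℂ →ₗ[ℝ] ℂ) (c : ℝ) (w : ℂ) :
    F ((c : ℂ) * w) = (c : ℂ) * F w := by
  rw [← Complex.real_smul, ← Complex.real_smul, map_smul]

/-- Every `ℝ`-linear map `F : ℂ → ℂ` is `z ↦ p z + q z̄` with `p = (F 1 − i F i)/2`,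
`q = (F 1 + i F i)/2`. [folklore] -/
private theorem apply_eq_mul_add_mul_conj (F : ℂ →ₗ[ℝ] ℂ) (z : ℂ) :
    F z = (F 1 - I * F I) / 2 * z + (F 1 + I * F I) / 2 * conj z := by
  have hz : z = (z.re : ℂ) + (z.im : ℂ) * I := (re_add_im z).symm
  have hF : F z = (z.re : ℂ) * F 1 + (z.im : ℂ) * F I := by
    conv_lhs => rw [hz]
    rw [map_add, map_ofReal_mul, show ((z.re : ℂ)) = (z.re : ℂ) * 1 by ring, map_ofReal_mul]
    ring
  have hconj : conj z = (z.re : ℂ) - (z.im : ℂ) * I := by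
    apply Complex.ext <;> simp
  rw [hF, hconj]
  apply Complex.ext <;> simp <;> ring

/-- `|A u + B v|² = |A|²|u|² + |B|²|v|² + 2 Re(A B̄ · u v̄)`. [folklore] -/
private theorem normSq_mul_add_mul (A B u v : ℂ) :
    normSq (A * u + B * v) =
      normSq A * normSq u + normSq B * normSq v + 2 * (A * conj B * (u * conj v)).re := by
  rw [normSq_add, normSq_mul, normSq_mul, map_mul]
  congr 2
  ring_nf

/-- The determinant `det(z, w) = Re z · Im w − Im z · Re w` of two vectors of `ℝ² ≅ ℂ` transforms
under `z ↦ p z + q z̄` by the factor `|p|² − |q|²` (the determinant of that `ℝ`-linear map).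
[folklore] -/
private theorem det_mul_add_mul_conj (p q z w : ℂ) :
    (p * z + q * conj z).re * (p * w + q * conj w).im
        - (p * z + q * conj z).im * (p * w + q * conj w).re =
      (normSq p - normSq q) * (z.re * w.im - z.im * w.re) := by
  simp only [mul_re, mul_im, add_re, add_im, conj_re, conj_im, normSq_apply]
  ring

/-- **An equilateral unit frame**: if `|e₁| = |e₂| = |e₂ − e₁| = 1` then `e₂ = t e₁` with
`t = e₂ ē₁`, `|t| = 1`, `Re t = ½` (so `t = e^{±iπ/3}`). [folklore] -/
private theorem frame_of_unit (e₁ e₂ : ℂ) (h1 : normSq e₁ = 1) (h2 : normSq e₂ = 1)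
    (h12 : normSq (e₂ - e₁) = 1) :
    normSq (e₂ * conj e₁) = 1 ∧ (e₂ * conj e₁).re = 1 / 2 ∧ e₂ = e₂ * conj e₁ * e₁ := by
  refine ⟨by rw [normSq_mul, normSq_conj, h1, h2, mul_one], ?_, ?_⟩
  · have h := normSq_sub e₂ e₁
    rw [h12, h1, h2] at h
    linarith
  · rw [mul_assoc, ← normSq_eq_conj_mul_self, h1]
    simp

/-! ### Lemma 4.2: the algebraic core -/

/-- From an equilateral unit frame `e₁, e₂` and the three squared-length deficits of
`z ↦ p z + q z̄` on `e₁, e₂, e₂ − e₁` bounded by `m`: `||p|² + |q|² − 1| ≤ m` and `|p|²|q|² ≤ 4m²`.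
[folklore] -/
private theorem trace_and_product_bounds {p q e₁ e₂ : ℂ} {m : ℝ} (h1 : normSq e₁ = 1)
    (h2 : normSq e₂ = 1) (h12 : normSq (e₂ - e₁) = 1)
    (hD0 : |normSq (p * e₁ + q * conj e₁) - 1| ≤ m)
    (hD1 : |normSq (p * e₂ + q * conj e₂) - 1| ≤ m)
    (hD2 : |normSq (p * (e₂ - e₁) + q * conj (e₂ - e₁)) - 1| ≤ m) :
    |normSq p + normSq q - 1| ≤ m ∧ normSq p * normSq q ≤ 4 * m ^ 2 := by
  obtain ⟨ht1, htre, he2⟩ := frame_of_unit e₁ e₂ h1 h2 h12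
  set t := e₂ * conj e₁ with ht
  have htim : t.im ^ 2 = 3 / 4 := by
    rw [normSq_apply] at ht1
    nlinarith [htre]
  -- `t² = t − 1`, `(t − 1)² = −t`
  have ht2 : t * t = t - 1 := by
    apply Complex.ext
    · simp only [mul_re, sub_re, one_re]; nlinarith [htre, htim]
    · simp only [mul_im, sub_im, one_im]; rw [htre]; ring
  have ht3 : (t - 1) * (t - 1) = -t := by linear_combination ht2
  -- the three values in terms of `u = p e₁`, `v = q ē₁`, `w = u v̄`
  set u := p * e₁ with hu
  set v := q * conj e₁ with hv
  set w := u * conj v with hw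
  have hs : normSq u + normSq v = normSq p + normSq q := by
    rw [hu, hv, normSq_mul, normSq_mul, normSq_conj, h1]; ring
  have e0 : p * e₁ + q * conj e₁ = 1 * u + 1 * v := by rw [hu, hv]; ring
  have e1 : p * e₂ + q * conj e₂ = t * u + conj t * v := by
    rw [he2, hu, hv, map_mul, map_mul, conj_conj]; ring
  have e2 : p * (e₂ - e₁) + q * conj (e₂ - e₁) = (t - 1) * u + (conj t - 1) * v := by
    rw [he2, hu, hv, map_sub, map_mul, map_mul, conj_conj]; ring
  have hn : normSq (t - 1) = 1 := by
    rw [← h12, he2, show e₂ * conj e₁ * e₁ - e₁ = (e₂ * conj e₁ - 1) * e₁ by ring, normSq_mul,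
      h1, mul_one]
  have hn' : normSq (conj t - 1) = 1 := by
    rw [← normSq_conj, map_sub, conj_conj, map_one, hn]
  have hc : conj (conj t - 1) = t - 1 := by rw [map_sub, conj_conj, map_one]
  have hn0 : normSq (p * e₁ + q * conj e₁) = normSq u + normSq v + 2 * w.re := by
    rw [e0, normSq_mul_add_mul]; simp [hw]
  have hn1 : normSq (p * e₂ + q * conj e₂) = normSq u + normSq v + 2 * ((t - 1) * w).re := by
    rw [e1, normSq_mul_add_mul, normSq_conj, ht1, conj_conj, ← ht2, hw]; ring_nf
  have hn2 : normSq (p * (e₂ - e₁) + q * conj (e₂ - e₁)) =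
      normSq u + normSq v - 2 * (t * w).re := by
    rw [e2, normSq_mul_add_mul, hn, hn', hc, hw, ht3]
    simp only [one_mul, neg_mul, neg_re]
    ring
  have hre1 : ((t - 1) * w).re = (t * w).re - w.re := by rw [sub_mul, one_mul, sub_re]
  -- linear algebra of the three values
  have hsum : 3 * (normSq p + normSq q - 1) =
      (normSq (p * e₁ + q * conj e₁) - 1) + (normSq (p * e₂ + q * conj e₂) - 1) +
        (normSq (p * (e₂ - e₁) + q * conj (e₂ - e₁)) - 1) := by
    rw [hn0, hn1, hn2, hre1, hs]; ring
  have hsabs : |normSq p + normSq q - 1| ≤ m := by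
    rw [abs_le] at hD0 hD1 hD2 ⊢
    constructor <;> linarith
  have hwre : |w.re| ≤ m := by
    rw [hn0, hs] at hD0
    rw [abs_le] at hD0 hsabs ⊢
    constructor <;> linarith
  have htw : |(t * w).re| ≤ m := by
    rw [hn2, hs] at hD2
    rw [abs_le] at hD2 hsabs ⊢
    constructor <;> linarith
  have hX : (t.im * w.im) ^ 2 ≤ (3 / 2 * m) ^ 2 := by
    have hre : (t * w).re = 1 / 2 * w.re - t.im * w.im := by rw [mul_re, htre]
    rw [hre, abs_le] at htw
    rw [abs_le] at hwre
    apply sq_le_sq' <;> linarith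
  have hwim : w.im ^ 2 ≤ 3 * m ^ 2 := by
    rw [mul_pow, htim] at hX
    linarith
  have hw4 : normSq w ≤ 4 * m ^ 2 := by
    rw [abs_le] at hwre
    have hre2 : w.re * w.re ≤ m ^ 2 := by nlinarith [hwre.1, hwre.2]
    rw [normSq_apply]
    nlinarith [hre2, hwim]
  have hPQ : normSq w = normSq p * normSq q := by
    rw [hw, hu, hv, normSq_mul, normSq_conj, normSq_mul, normSq_mul, normSq_conj, h1]; ring
  exact ⟨hsabs, hPQ ▸ hw4⟩

/-- For an equilateral unit frame `e₁, e₂` and `M z = p z + q z̄`: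
`|M e₁|² + |M e₂|² + |M(e₂ − e₁)|² = 3(|p|² + |q|²)` — the cross terms cancel because
`e₁² + e₂² + (e₂ − e₁)² = 2 e₁² (t² − t + 1) = 0` for `e₂ = t e₁`, `t = e^{±iπ/3}`. [folklore] -/
private theorem sum_normSq_frame {p q e₁ e₂ : ℂ} (h1 : normSq e₁ = 1) (h2 : normSq e₂ = 1)
    (h12 : normSq (e₂ - e₁) = 1) :
    normSq (p * e₁ + q * conj e₁) + normSq (p * e₂ + q * conj e₂) +
        normSq (p * (e₂ - e₁) + q * conj (e₂ - e₁)) = 3 * (normSq p + normSq q) := by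
  obtain ⟨ht1, htre, he2⟩ := frame_of_unit e₁ e₂ h1 h2 h12
  set t := e₂ * conj e₁ with ht
  have htim : t.im ^ 2 = 3 / 4 := by
    rw [normSq_apply] at ht1
    nlinarith [htre]
  have ht2 : t * t = t - 1 := by
    apply Complex.ext
    · simp only [mul_re, sub_re, one_re]; nlinarith [htre, htim]
    · simp only [mul_im, sub_im, one_im]; rw [htre]; ring
  have hexp : ∀ u : ℂ, normSq (p * u + q * conj u) =
      (normSq p + normSq q) * normSq u + 2 * (p * conj q * (u * u)).re := by
    intro u
    rw [normSq_mul_add_mul, normSq_conj, conj_conj]; ring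
  have hsq : e₁ * e₁ + e₂ * e₂ + (e₂ - e₁) * (e₂ - e₁) = 0 := by
    rw [he2]; linear_combination (2 * e₁ * e₁) * ht2
  have hre : (p * conj q * (e₁ * e₁)).re + (p * conj q * (e₂ * e₂)).re +
      (p * conj q * ((e₂ - e₁) * (e₂ - e₁))).re = 0 := by
    rw [← add_re, ← add_re, ← mul_add, ← mul_add, hsq, mul_zero, zero_re]
  rw [hexp, hexp, hexp, h1, h2, h12]
  linarith [hre]

/-- Real arithmetic: `|P + Q − 1| ≤ m ≤ 1/16`, `P Q ≤ 4m²`, `0 ≤ Q ≤ P` force `Q ≤ 5m²`,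
`|P − 1| ≤ 2m` and `13/16 ≤ P ≤ 17/16`. [folklore] -/
private theorem real_bounds {P Q m : ℝ} (hQ0 : 0 ≤ Q) (hm : m ≤ 1 / 16)
    (hs : |P + Q - 1| ≤ m) (hPQ : P * Q ≤ 4 * m ^ 2) (hor : Q ≤ P) :
    Q ≤ 5 * m ^ 2 ∧ |P - 1| ≤ 2 * m ∧ 13 / 16 ≤ P ∧ P ≤ 17 / 16 := by
  have hm0 : 0 ≤ m := le_trans (abs_nonneg _) hs
  rw [abs_le] at hs
  have hQQ : Q ^ 2 ≤ (2 * m) ^ 2 := by nlinarith [mul_le_mul_of_nonneg_left hor hQ0]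
  have hQ2 : Q ≤ 2 * m := (pow_le_pow_iff_left₀ hQ0 (by positivity) two_ne_zero).1 hQQ
  have hP1 : 13 / 16 ≤ P := by linarith
  have hP2 : P ≤ 17 / 16 := by linarith
  have hQ5 : Q ≤ 5 * m ^ 2 := by nlinarith [mul_le_mul_of_nonneg_left hP1 hQ0]
  have hmm : m ^ 2 ≤ m / 16 := by nlinarith
  refine ⟨hQ5, ?_, hP1, hP2⟩
  rw [abs_le]
  constructor <;> nlinarith

/-! ### Lemma 4.2 as printed, in complex coordinates `ℝ² ≅ ℂ` -/

/-- For `M z = c z + q z̄`: `‖M 1‖² + ‖M i‖² = 2|c|² + 2|q|²` (the squared Frobenius norm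
`trace(MᵀM)` of the matrix of `M` in the orthonormal basis `(1, i)`). [folklore] -/
private theorem frob_of_mul_add_mul_conj (c q : ℂ) :
    ‖c * 1 + q * conj 1‖ ^ 2 + ‖c * I + q * conj I‖ ^ 2 = 2 * normSq c + 2 * normSq q := by
  rw [Complex.sq_norm, Complex.sq_norm, map_one, conj_I, mul_one, mul_one, mul_neg,
    ← sub_eq_add_neg, ← sub_mul, normSq_mul, normSq_I, mul_one, normSq_add, normSq_sub]
  ring

/-- `|p − p/|p||² = (|p| − 1)²` for `p ≠ 0`. [folklore] -/
private theorem normSq_sub_div_norm {p : ℂ} (hp : p ≠ 0) :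
    normSq (p - p / (‖p‖ : ℂ)) = (‖p‖ - 1) ^ 2 := by
  have hn : (‖p‖ : ℝ) ≠ 0 := norm_ne_zero_iff.2 hp
  have e : p - p / (‖p‖ : ℂ) = p * ((1 - ‖p‖⁻¹ : ℝ) : ℂ) := by
    push_cast
    field_simp
  rw [e, normSq_mul, normSq_ofReal, Complex.normSq_eq_norm_sq]
  field_simp

/-- `|c p̄ − p̄/|p||² = |p|² (c − |p|⁻¹)²` for `p ≠ 0` and real `c`. [folklore] -/
private theorem normSq_mul_conj_sub_div_norm {p : ℂ} (hp : p ≠ 0) (c : ℝ) :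
    normSq ((c : ℂ) * conj p - conj p / (‖p‖ : ℂ)) = ‖p‖ ^ 2 * (c - ‖p‖⁻¹) ^ 2 := by
  have hn : (‖p‖ : ℝ) ≠ 0 := norm_ne_zero_iff.2 hp
  have e : (c : ℂ) * conj p - conj p / (‖p‖ : ℂ) = conj p * ((c - ‖p‖⁻¹ : ℝ) : ℂ) := by
    push_cast
    field_simp
  rw [e, normSq_mul, normSq_conj, normSq_ofReal, Complex.normSq_eq_norm_sq]
  ring

/-- The determinant of two vectors of `ℝ² ≅ ℂ`: `det(z, w) = Im(z̄ w)`. [folklore] -/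
private theorem det_eq_im_conj_mul (z w : ℂ) : z.re * w.im - z.im * w.re = (conj z * w).im := by
  simp only [mul_im, conj_re, conj_im]
  ring

/-- Orientation: for an equilateral unit frame `e₁, e₂`, the sign condition
`det(F e₁, F e₂) · det(e₁, e₂) ≥ 0` for `F z = p z + q z̄` gives `|q| ≤ |p|` (`det F = |p|² − |q|²`,
`det(e₁, e₂)² = 3/4`). [folklore] -/
private theorem normSq_le_of_orientation {p q e₁ e₂ : ℂ} (h1 : normSq e₁ = 1)
    (h2 : normSq e₂ = 1) (h12 : normSq (e₂ - e₁) = 1)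
    (hor : 0 ≤ ((p * e₁ + q * conj e₁).re * (p * e₂ + q * conj e₂).im
        - (p * e₁ + q * conj e₁).im * (p * e₂ + q * conj e₂).re) *
        (e₁.re * e₂.im - e₁.im * e₂.re)) :
    normSq q ≤ normSq p := by
  obtain ⟨ht1, htre, -⟩ := frame_of_unit e₁ e₂ h1 h2 h12
  have htim : (e₂ * conj e₁).im ^ 2 = 3 / 4 := by
    rw [normSq_apply] at ht1; nlinarith [htre]
  rw [det_mul_add_mul_conj, det_eq_im_conj_mul, mul_comm (conj e₁) e₂, mul_assoc, ← sq, htim]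
    at hor
  linarith

/-- Real arithmetic of (50): `2(ρ − 1)² + 2Q ≤ 500 m²` from `|ρ² − 1| ≤ 6m`, `Q ≤ 45 m²`,
`ρ ≥ 0`. [folklore] -/
private theorem frob_bound_50 {ρ Q m : ℝ} (hρ : 0 ≤ ρ) (hP1 : |ρ ^ 2 - 1| ≤ 2 * (3 * m))
    (hQ : Q ≤ 5 * (3 * m) ^ 2) : 2 * (ρ - 1) ^ 2 + 2 * Q ≤ 500 * m ^ 2 := by
  rw [abs_le] at hP1
  have h : |ρ - 1| ≤ 6 * m := by
    rw [abs_le]; constructor <;> nlinarith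
  rw [abs_le] at h
  nlinarith [h.1, h.2]

/-- Real arithmetic of (51): with `D = ρ² − Q`, `2 ρ² (D⁻¹ − ρ⁻¹)² + 2 D⁻² Q ≤ 500 m²` from
`13/16 ≤ ρ² ≤ 17/16`, `|ρ² − 1| ≤ 6m`, `0 ≤ Q ≤ 45 m²`, `m ≤ 1/48`. [folklore] -/
private theorem frob_bound_51 {ρ Q m : ℝ} (hρ : 0 ≤ ρ) (hPlo : 13 / 16 ≤ ρ ^ 2)
    (hPhi : ρ ^ 2 ≤ 17 / 16) (hP1 : |ρ ^ 2 - 1| ≤ 2 * (3 * m)) (hQ0 : 0 ≤ Q)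
    (hQ : Q ≤ 5 * (3 * m) ^ 2) (hm : m ≤ 1 / 48) :
    2 * (ρ ^ 2 * ((ρ ^ 2 - Q)⁻¹ - ρ⁻¹) ^ 2) + 2 * ((ρ ^ 2 - Q)⁻¹ * (ρ ^ 2 - Q)⁻¹ * Q) ≤
      500 * m ^ 2 := by
  have hm0 : 0 ≤ m := by linarith only [abs_nonneg (ρ ^ 2 - 1), hP1]
  have hmm : m ^ 2 ≤ m / 48 := by nlinarith only [hm0, hm]
  have hQm : Q ≤ m := by nlinarith only [hQ, hmm]
  have hρlo : 9 / 10 ≤ ρ :=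
    (pow_le_pow_iff_left₀ (by norm_num) hρ two_ne_zero).1 (by linarith only [hPlo])
  have hρhi : ρ ≤ 11 / 10 :=
    (pow_le_pow_iff_left₀ hρ (by norm_num) two_ne_zero).1 (by linarith only [hPhi])
  have hDlo : 3 / 4 ≤ ρ ^ 2 - Q := by linarith only [hPlo, hQm, hm]
  have hDpos : 0 < ρ ^ 2 - Q := by linarith only [hDlo]
  have hρpos : 0 < ρ := by linarith only [hρlo]
  rw [abs_le] at hP1
  have hr1 : -(4 * m) ≤ ρ - 1 ∧ ρ - 1 ≤ 4 * m := by
    constructor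
    · nlinarith only [hP1.1, hρlo, hm0]
    · nlinarith only [hP1.2, hρlo, hm0]
  have hr2 : -(5 * m) ≤ ρ * (ρ - 1) ∧ ρ * (ρ - 1) ≤ 5 * m := by
    constructor
    · nlinarith only [hr1.1, hρhi, hρpos, hm0]
    · nlinarith only [hr1.2, hρhi, hρpos, hm0]
  have hsq : (ρ - (ρ ^ 2 - Q)) ^ 2 ≤ (8 * m) ^ 2 := by
    have e : ρ - (ρ ^ 2 - Q) = -(ρ * (ρ - 1)) + Q := by ring
    rw [e]
    apply sq_le_sq' <;> nlinarith only [hr2.1, hr2.2, hQ0, hQm]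
  -- first term
  have hx : (ρ ^ 2 - Q)⁻¹ - ρ⁻¹ = (ρ - (ρ ^ 2 - Q)) / ((ρ ^ 2 - Q) * ρ) :=
    inv_sub_inv hDpos.ne' hρpos.ne'
  have hden : (27 / 40) ^ 2 ≤ ((ρ ^ 2 - Q) * ρ) ^ 2 := by
    apply pow_le_pow_left₀ (by norm_num)
    nlinarith only [hDlo, hρlo]
  have t1 : ((ρ ^ 2 - Q)⁻¹ - ρ⁻¹) ^ 2 ≤ (8 * m) ^ 2 / (27 / 40) ^ 2 := by
    rw [hx, div_pow]
    exact div_le_div₀ (by positivity) hsq (by positivity) hden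
  have t1' : ρ ^ 2 * ((ρ ^ 2 - Q)⁻¹ - ρ⁻¹) ^ 2 ≤ 17 / 16 * ((8 * m) ^ 2 / (27 / 40) ^ 2) :=
    mul_le_mul hPhi t1 (sq_nonneg _) (by norm_num)
  -- second term
  have hDi : (ρ ^ 2 - Q)⁻¹ ≤ 4 / 3 := by
    rw [inv_le_comm₀ hDpos (by norm_num)]; linarith only [hDlo]
  have hDi0 : 0 ≤ (ρ ^ 2 - Q)⁻¹ := inv_nonneg.2 hDpos.le
  have t2 : (ρ ^ 2 - Q)⁻¹ * (ρ ^ 2 - Q)⁻¹ * Q ≤ 4 / 3 * (4 / 3) * (45 * m ^ 2) := by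
    have h1 : (ρ ^ 2 - Q)⁻¹ * (ρ ^ 2 - Q)⁻¹ ≤ 4 / 3 * (4 / 3) :=
      mul_le_mul hDi hDi hDi0 (by norm_num)
    exact mul_le_mul h1 (by nlinarith only [hQ]) hQ0 (by norm_num)
  have t1n : ρ ^ 2 * ((ρ ^ 2 - Q)⁻¹ - ρ⁻¹) ^ 2 ≤ 17 / 16 * (102400 / 729 * m ^ 2) := by
    rw [show (8 * m) ^ 2 / (27 / 40 : ℝ) ^ 2 = 102400 / 729 * m ^ 2 by ring] at t1'
    exact t1'
  have hsum := add_le_add (mul_le_mul_of_nonneg_left t1n (by norm_num : (0 : ℝ) ≤ 2))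
    (mul_le_mul_of_nonneg_left t2 (by norm_num : (0 : ℝ) ≤ 2))
  refine hsum.trans ?_
  have : 0 ≤ m ^ 2 := sq_nonneg m
  linarith only [this]

/-- **Theil 2006, Lemma 4.2** (Appendix §4.1, preprint p. 17; the local rigidity of one
simplex), in complex coordinates `ℝ² ≅ ℂ`. "There exist two universal constants `K, α₀ > 0` such
that for each pair of triples `y_i, η_i ∈ ℝ²`, `i = 0, 1, 2` with the properties
`det(y₁ − y₀, y₂ − y₀) det(η₁ − η₀, η₂ − η₀) ≥ 0`, `||y_i − y_j| − 1| ≤ α₀` and `|η_i − η_j| = 1` if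
`i ≠ j` the inequalities (50) `min_{R ∈ SO(2)} |F − R|² ≤ K max_{i≠j} ||y_i − y_j| − 1|²`,
(51) `min_{R ∈ SO(2)} |F⁻¹ − R|² ≤ K max_{i≠j} ||y_i − y_j| − 1|²` hold, where
`|M| := √trace(MᵀM)` for a `2 × 2`-matrix `M`. The matrix `F ∈ ℝ^{2×2}` is the gradient of the
unique affine map `u : conv{η₀, η₁, η₂} → ℝ²` which satisfies `u(η_i) = y_i` for `i = 0, 1, 2`."
Rendering: points of `ℝ²` are complex numbers; `det(z, w) = Re z Im w − Im z Re w`; `F` is an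
`ℝ`-linear map of `ℂ` with `F(η_i − η₀) = y_i − y₀` (= the gradient of that affine map); a
rotation `R ∈ SO(2)` is `z ↦ r z` with `|r| = 1` (`LinearMap.mulLeft ℝ r`); `|M|² = trace(MᵀM)`
is `‖M 1‖² + ‖M i‖²` (orthonormal basis `(1, i)`); the bound on the minimum over `SO(2)` is
witnessed by an explicit rotation; `max_{i≠j} ||y_i − y_j| − 1| ≤ α₀` enters as any common bound
`m ≤ α₀` of the three deficits; `F⁻¹` is an `ℝ`-linear two-sided inverse `G` of `F` (it exists
under the hypotheses). Constants: `K = 500`, `α₀ = 1/48` (the paper's are unspecified).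
Proof (ours; the paper argues via `G = FᵀF − Id` and the polar decomposition): in the normal form
`F z = p z + q z̄` of an `ℝ`-linear map of `ℂ` one has `det F = |p|² − |q|²` and, for `|q| ≤ |p|`,
`dist(F, SO(2))² = 2(|p| − 1)² + 2|q|²` attained at `R z = (p/|p|) z`; along the equilateral frame
`e₂ = t e₁` (`t = e^{±iπ/3}`, `t² = t − 1`) the three squared edge deficits are
`|p|² + |q|² − 1 + 2 Re w`, `… + 2 Re((t − 1) w)`, `… − 2 Re(t w)` with `w = p q̄ e₁²`, whence
`||p|² + |q|² − 1| ≤ 3m` and `|p||q| ≤ 6m`; the orientation hypothesis gives `|q| ≤ |p|`, so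
`|q|² ≤ 45 m²`, `||p|² − 1| ≤ 6m`; and `F⁻¹ z = (p̄ z − q z̄)/(|p|² − |q|²)` with
`R' z = (p̄/|p|) z`. [cite: Theil2006, §4.1 Lemma 4.2 (50)–(51) (preprint pp. 17–18)] -/
theorem simplex_rigidity :
    ∃ K α₀ : ℝ, 0 < K ∧ 0 < α₀ ∧ ∀ (y η : Fin 3 → ℂ) (F : ℂ →ₗ[ℝ] ℂ),
      0 ≤ ((y 1 - y 0).re * (y 2 - y 0).im - (y 1 - y 0).im * (y 2 - y 0).re) *
            ((η 1 - η 0).re * (η 2 - η 0).im - (η 1 - η 0).im * (η 2 - η 0).re) →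
      (∀ i j : Fin 3, i ≠ j → ‖η i - η j‖ = 1) →
      (∀ i : Fin 3, F (η i - η 0) = y i - y 0) →
      ∀ m : ℝ, m ≤ α₀ → (∀ i j : Fin 3, i ≠ j → |‖y i - y j‖ - 1| ≤ m) →
        (∃ r : ℂ, ‖r‖ = 1 ∧
          ‖(F - LinearMap.mulLeft ℝ r) 1‖ ^ 2 + ‖(F - LinearMap.mulLeft ℝ r) I‖ ^ 2 ≤ K * m ^ 2) ∧
        (∃ (G : ℂ →ₗ[ℝ] ℂ) (r : ℂ), G.comp F = LinearMap.id ∧ F.comp G = LinearMap.id ∧ ‖r‖ = 1 ∧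
          ‖(G - LinearMap.mulLeft ℝ r) 1‖ ^ 2 + ‖(G - LinearMap.mulLeft ℝ r) I‖ ^ 2 ≤ K * m ^ 2) := by
  refine ⟨500, 1 / 48, by norm_num, by norm_num, fun y η F hor hη hF m hmα hdef => ?_⟩
  -- the frame
  set e₁ : ℂ := η 1 - η 0 with he₁
  set e₂ : ℂ := η 2 - η 0 with he₂
  have hn1 : normSq e₁ = 1 := by
    rw [Complex.normSq_eq_norm_sq, he₁, hη 1 0 (by decide), one_pow]
  have hn2 : normSq e₂ = 1 := by
    rw [Complex.normSq_eq_norm_sq, he₂, hη 2 0 (by decide), one_pow]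
  have hn12 : normSq (e₂ - e₁) = 1 := by
    rw [Complex.normSq_eq_norm_sq, he₂, he₁, show η 2 - η 0 - (η 1 - η 0) = η 2 - η 1 by ring,
      hη 2 1 (by decide), one_pow]
  -- the normal form of `F`
  set p : ℂ := (F 1 - I * F I) / 2 with hp
  set q : ℂ := (F 1 + I * F I) / 2 with hq
  have hFz : ∀ z, F z = p * z + q * conj z := apply_eq_mul_add_mul_conj F
  -- the three squared deficits are `≤ 3m`
  have hsq : ∀ z : ℂ, |‖z‖ - 1| ≤ m → |normSq z - 1| ≤ 3 * m := by
    intro z hz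
    rw [Complex.normSq_eq_norm_sq]
    rw [abs_le] at hz ⊢
    have hm1 : m ≤ 1 := by linarith
    constructor <;> nlinarith [norm_nonneg z]
  have hFe₁ : F e₁ = y 1 - y 0 := hF 1
  have hFe₂ : F e₂ = y 2 - y 0 := hF 2
  have hFe₁₂ : F (e₂ - e₁) = y 2 - y 1 := by rw [map_sub, hFe₁, hFe₂]; ring
  have hD0 : |normSq (p * e₁ + q * conj e₁) - 1| ≤ 3 * m := by
    rw [← hFz, hFe₁]; exact hsq _ (hdef 1 0 (by decide))
  have hD1 : |normSq (p * e₂ + q * conj e₂) - 1| ≤ 3 * m := by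
    rw [← hFz, hFe₂]; exact hsq _ (hdef 2 0 (by decide))
  have hD2 : |normSq (p * (e₂ - e₁) + q * conj (e₂ - e₁)) - 1| ≤ 3 * m := by
    rw [← hFz, hFe₁₂]; exact hsq _ (hdef 2 1 (by decide))
  obtain ⟨hs, hPQ⟩ := trace_and_product_bounds hn1 hn2 hn12 hD0 hD1 hD2
  -- orientation: `|q|² ≤ |p|²`
  have horPQ : normSq q ≤ normSq p := by
    rw [← hFe₁, ← hFe₂, hFz, hFz] at hor
    exact normSq_le_of_orientation hn1 hn2 hn12 hor
  obtain ⟨hQ, hP1abs, hPlo, hPhi⟩ :=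
    real_bounds (normSq_nonneg q) (by linarith) hs hPQ horPQ
  -- `ρ = |p| > 0`
  have hP : normSq p = ‖p‖ ^ 2 := Complex.normSq_eq_norm_sq p
  rw [hP] at hP1abs hPlo hPhi
  have hρpos : 0 < ‖p‖ := by
    have h := norm_nonneg p
    rcases h.lt_or_eq with h | h
    · exact h
    · exfalso; rw [← h] at hPlo; norm_num at hPlo
  have hp0 : p ≠ 0 := norm_pos_iff.1 hρpos
  refine ⟨⟨p / (‖p‖ : ℂ), ?_, ?_⟩, ?_⟩
  · rw [norm_div, Complex.norm_real, Real.norm_eq_abs, abs_of_pos hρpos, div_self hρpos.ne']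
  · -- (50) with `R z = (p/|p|) z`
    have e : ∀ z, (F - LinearMap.mulLeft ℝ (p / (‖p‖ : ℂ))) z =
        (p - p / (‖p‖ : ℂ)) * z + q * conj z := by
      intro z
      rw [LinearMap.sub_apply, LinearMap.mulLeft_apply, hFz]; ring
    rw [e, e, frob_of_mul_add_mul_conj, normSq_sub_div_norm hp0]
    exact frob_bound_50 (norm_nonneg p) hP1abs hQ
  · -- (51): `G z = (p̄ z − q z̄)/(|p|² − |q|²)`, `R' z = (p̄/|p|) z`
    have hm0 : 0 ≤ m := le_trans (abs_nonneg _) (hdef 1 0 (by decide))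
    have hmm : m ^ 2 ≤ m / 48 := by nlinarith only [hm0, hmα]
    set D : ℝ := ‖p‖ ^ 2 - normSq q with hD
    have hDpos : 0 < D := by rw [hD]; nlinarith only [hPlo, hQ, hmm, hmα]
    let G : ℂ →ₗ[ℝ] ℂ := (D⁻¹ : ℝ) •
      (LinearMap.mulLeft ℝ (conj p) - (LinearMap.mulLeft ℝ q).comp Complex.conjAe.toLinearMap)
    have hG : ∀ z, G z = ((D⁻¹ : ℝ) : ℂ) * (conj p * z - q * conj z) := by
      intro z
      simp only [G, LinearMap.smul_apply, LinearMap.sub_apply, LinearMap.mulLeft_apply,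
        LinearMap.comp_apply, AlgEquiv.toLinearMap_apply, Complex.conjAe_coe, Complex.real_smul]
    have hDC : ((D : ℝ) : ℂ) = conj p * p - conj q * q := by
      rw [hD, ← hP, Complex.ofReal_sub, Complex.normSq_eq_conj_mul_self,
        Complex.normSq_eq_conj_mul_self]
    have hDinv : ((D⁻¹ : ℝ) : ℂ) * ((D : ℝ) : ℂ) = 1 := by
      rw [← Complex.ofReal_mul, inv_mul_cancel₀ hDpos.ne', Complex.ofReal_one]
    have hGF : G.comp F = LinearMap.id := by
      apply LinearMap.ext
      intro z
      rw [LinearMap.comp_apply, LinearMap.id_apply, hG, hFz, map_add, map_mul, map_mul, conj_conj]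
      have : conj p * (p * z + q * conj z) - q * (conj p * conj z + conj q * z) =
          (conj p * p - conj q * q) * z := by ring
      rw [this, ← hDC, ← mul_assoc, hDinv, one_mul]
    have hFG : F.comp G = LinearMap.id := by
      apply LinearMap.ext
      intro z
      rw [LinearMap.comp_apply, LinearMap.id_apply, hFz, hG, map_mul, Complex.conj_ofReal, map_sub,
        map_mul, map_mul, conj_conj, conj_conj]
      have : p * (((D⁻¹ : ℝ) : ℂ) * (conj p * z - q * conj z)) +
          q * (((D⁻¹ : ℝ) : ℂ) * (p * conj z - conj q * z)) =
          ((D⁻¹ : ℝ) : ℂ) * ((conj p * p - conj q * q) * z) := by ring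
      rw [this, ← hDC, ← mul_assoc, hDinv, one_mul]
    refine ⟨G, conj p / (‖p‖ : ℂ), hGF, hFG, ?_, ?_⟩
    · rw [norm_div, Complex.norm_conj, Complex.norm_real, Real.norm_eq_abs, abs_of_pos hρpos,
        div_self hρpos.ne']
    · have e : ∀ z, (G - LinearMap.mulLeft ℝ (conj p / (‖p‖ : ℂ))) z =
          (((D⁻¹ : ℝ) : ℂ) * conj p - conj p / (‖p‖ : ℂ)) * z
            + (-(((D⁻¹ : ℝ) : ℂ) * q)) * conj z := by
        intro z
        rw [LinearMap.sub_apply, LinearMap.mulLeft_apply, hG]; ring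
      rw [e, e, frob_of_mul_add_mul_conj, normSq_neg, normSq_mul, normSq_ofReal,
        normSq_mul_conj_sub_div_norm hp0, hD]
      exact frob_bound_51 (norm_nonneg p) hPlo hPhi hP1abs (normSq_nonneg q) hQ hmα

/-- **Theil 2006, proof of Proposition 4.3, first display (preprint p. 18)** — the form in
which Lemma 4.2 (50) is USED: "By Lemma 4.2 for each triple `{x₁, x₂, x₃} ⊂ A₂` with the
property `|x_i − x_j| = 1` if `i ≠ j` and each `x ∈ int(conv{x₁, x₂, x₃})` we have that
`dist(∇u(x), SO(2)) ≤ K Σ_{i≠j} ||u(x_i) − u(x_j)| − 1|²`." Here `u` is affine on the simplex, so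
`∇u(x) = F` with `F(x_i − x₁) = u(x_i) − u(x_1)`; rendering as in `simplex_rigidity` (complex
coordinates, rotations `z ↦ r z`, squared Frobenius norm `‖M 1‖² + ‖M i‖²`), with the sum over
the three (unordered) pairs — the ordered sum is twice it, absorbed in `K`.
READ BEFORE USE — two print flags, both documented here rather than silently repaired:
(1) the display is printed with `dist` UNSQUARED on the left; what Lemma 4.2 gives, what (53)
consumes and what we prove is `dist² ≤ K Σ deficit²` (the unsquared form fails for
`F = (1 + δ) Id`, deficits `δ`, `dist = √2 δ > 6Kδ²` for small `δ`); (2) the display is invoked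
without the two standing hypotheses of Lemma 4.2: the smallness `max deficit ≤ α₀` is indeed
unnecessary (this theorem: for a deficit `> α₀` already `|F − Id|² ≤ 4(1 + max deficit)² + 4 ≤
K' max deficit²`), but the orientation hypothesis `det · det ≥ 0` is NOT removable — see
`frob_sq_conj_sub_rotation` (a reflection preserves all edge lengths and is at squared distance
`4` from every rotation); in the paper the maps to which Lemma 4.2 / Proposition 4.3 are applied
interpolate the configuration against a discrete imbedding (`u = y ∘ Φ_T⁻¹` on a dilated lattice
simplex, pp. 10–11; `u(y(x)) = Φ(x)`, p. 23), and discrete imbeddings are orientation preserving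
by Definition 2.4 (20) — precisely the hypothesis `det · det ≥ 0`, so we keep it.
[cite: Theil2006, §4.1 proof of Prop. 4.3, first display (preprint p. 18), from Lemma 4.2 (50)] -/
theorem simplex_rigidity_sum :
    ∃ K : ℝ, 0 < K ∧ ∀ (y η : Fin 3 → ℂ) (F : ℂ →ₗ[ℝ] ℂ),
      0 ≤ ((y 1 - y 0).re * (y 2 - y 0).im - (y 1 - y 0).im * (y 2 - y 0).re) *
            ((η 1 - η 0).re * (η 2 - η 0).im - (η 1 - η 0).im * (η 2 - η 0).re) →
      (∀ i j : Fin 3, i ≠ j → ‖η i - η j‖ = 1) →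
      (∀ i : Fin 3, F (η i - η 0) = y i - y 0) →
      ∃ r : ℂ, ‖r‖ = 1 ∧
        ‖(F - LinearMap.mulLeft ℝ r) 1‖ ^ 2 + ‖(F - LinearMap.mulLeft ℝ r) I‖ ^ 2 ≤
          K * ((‖y 1 - y 0‖ - 1) ^ 2 + (‖y 2 - y 0‖ - 1) ^ 2 + (‖y 2 - y 1‖ - 1) ^ 2) := by
  obtain ⟨K, α₀, hK, hα₀, h⟩ := simplex_rigidity
  refine ⟨K + (4 * (1 / α₀ + 1) ^ 2 + 4 / α₀ ^ 2), by positivity, fun y η F hor hη hF => ?_⟩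
  -- `m` = the largest deficit, `S` = the sum of the squared deficits, `m² ≤ S`
  set S : ℝ := (‖y 1 - y 0‖ - 1) ^ 2 + (‖y 2 - y 0‖ - 1) ^ 2 + (‖y 2 - y 1‖ - 1) ^ 2 with hS
  set m : ℝ := max |‖y 1 - y 0‖ - 1| (max |‖y 2 - y 0‖ - 1| |‖y 2 - y 1‖ - 1|) with hm
  have h10 : |‖y 1 - y 0‖ - 1| ≤ m := le_max_left _ _
  have h20 : |‖y 2 - y 0‖ - 1| ≤ m := le_max_of_le_right (le_max_left _ _)
  have h21 : |‖y 2 - y 1‖ - 1| ≤ m := le_max_of_le_right (le_max_right _ _)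
  have hm0 : 0 ≤ m := le_trans (abs_nonneg _) h10
  have s1 := sq_nonneg (‖y 1 - y 0‖ - 1)
  have s2 := sq_nonneg (‖y 2 - y 0‖ - 1)
  have s3 := sq_nonneg (‖y 2 - y 1‖ - 1)
  have hS0 : 0 ≤ S := by rw [hS]; positivity
  have hmS : m ^ 2 ≤ S := by
    rcases max_choice |‖y 1 - y 0‖ - 1| (max |‖y 2 - y 0‖ - 1| |‖y 2 - y 1‖ - 1|) with hc | hc
    · rw [hm, hc, sq_abs, hS]; linarith
    · rcases max_choice |‖y 2 - y 0‖ - 1| |‖y 2 - y 1‖ - 1| with hc' | hc'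
      · rw [hm, hc, hc', sq_abs, hS]; linarith
      · rw [hm, hc, hc', sq_abs, hS]; linarith
  have hdef : ∀ i j : Fin 3, i ≠ j → |‖y i - y j‖ - 1| ≤ m := by
    have key : ∀ a b : ℂ, |‖a - b‖ - 1| ≤ m → |‖b - a‖ - 1| ≤ m := fun a b hab => by
      rwa [norm_sub_rev]
    intro i j hij
    fin_cases i <;> fin_cases j
    · exact absurd rfl hij
    · exact key _ _ h10
    · exact key _ _ h20
    · exact h10
    · exact absurd rfl hij
    · exact key _ _ h21
    · exact h20
    · exact h21
    · exact absurd rfl hij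
  rcases le_or_gt m α₀ with hle | hlt
  · -- small deficits: Lemma 4.2 (50)
    obtain ⟨r, hr, h50⟩ := (h y η F hor hη hF m hle hdef).1
    refine ⟨r, hr, h50.trans ?_⟩
    have h1 : K * m ^ 2 ≤ K * S := mul_le_mul_of_nonneg_left hmS hK.le
    have h2 : 0 ≤ (4 * (1 / α₀ + 1) ^ 2 + 4 / α₀ ^ 2) * S := by positivity
    linarith
  · -- a deficit larger than `α₀`: the identity rotation will do
    refine ⟨1, norm_one, ?_⟩
    -- the frame and the normal form, as in `simplex_rigidity`
    have hn1 : normSq (η 1 - η 0) = 1 := by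
      rw [Complex.normSq_eq_norm_sq, hη 1 0 (by decide), one_pow]
    have hn2 : normSq (η 2 - η 0) = 1 := by
      rw [Complex.normSq_eq_norm_sq, hη 2 0 (by decide), one_pow]
    have hn12 : normSq (η 2 - η 0 - (η 1 - η 0)) = 1 := by
      rw [Complex.normSq_eq_norm_sq, show η 2 - η 0 - (η 1 - η 0) = η 2 - η 1 by ring,
        hη 2 1 (by decide), one_pow]
    set p : ℂ := (F 1 - I * F I) / 2 with hp
    set q : ℂ := (F 1 + I * F I) / 2 with hq
    have hFz : ∀ z, F z = p * z + q * conj z := apply_eq_mul_add_mul_conj F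
    -- `3(|p|² + |q|²) = |y₁ − y₀|² + |y₂ − y₀|² + |y₂ − y₁|² ≤ 3 (1 + m)²`
    have hF12 : F (η 2 - η 0 - (η 1 - η 0)) = y 2 - y 1 := by
      rw [map_sub, hF 1, hF 2]; ring
    have hsum := sum_normSq_frame (p := p) (q := q) hn1 hn2 hn12
    rw [← hFz, ← hFz, ← hFz, hF 1, hF 2, hF12, Complex.normSq_eq_norm_sq,
      Complex.normSq_eq_norm_sq, Complex.normSq_eq_norm_sq] at hsum
    have hb : ∀ a : ℂ, |‖a‖ - 1| ≤ m → ‖a‖ ^ 2 ≤ (1 + m) ^ 2 := by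
      intro a ha
      rw [abs_le] at ha
      have : ‖a‖ ≤ 1 + m := by linarith
      exact pow_le_pow_left₀ (norm_nonneg a) this 2
    have hPQ : normSq p + normSq q ≤ (1 + m) ^ 2 := by
      have := hb _ h10; have := hb _ h20; have := hb _ h21
      linarith
    -- `|F − Id|² = 2|p − 1|² + 2|q|² ≤ 4(|p|² + |q|²) + 4`
    have e : ∀ z, (F - LinearMap.mulLeft ℝ (1 : ℂ)) z = (p - 1) * z + q * conj z := by
      intro z
      rw [LinearMap.sub_apply, LinearMap.mulLeft_apply, hFz]; ring
    rw [e, e, frob_of_mul_add_mul_conj]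
    have hp1 : normSq (p - 1) ≤ 2 * normSq p + 2 := by
      have e1 : normSq (p - 1) = normSq p + 1 - 2 * p.re := by
        rw [normSq_apply, normSq_apply, sub_re, sub_im, one_re, one_im]; ring
      rw [e1, normSq_apply]
      nlinarith [sq_nonneg (p.re + 1), sq_nonneg p.im]
    -- constants: `α₀ < m` gives `1 + m ≤ m (1/α₀ + 1)` and `4 ≤ 4 m²/α₀²`
    set K₂ : ℝ := 4 * (1 / α₀ + 1) ^ 2 + 4 / α₀ ^ 2 with hK₂
    have hK₂0 : 0 ≤ K₂ := by rw [hK₂]; positivity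
    have hq0 : 0 ≤ normSq q := normSq_nonneg q
    have hdiv : 1 < m / α₀ := (one_lt_div hα₀).2 hlt
    have h1m : (1 + m) ^ 2 ≤ m ^ 2 * (1 / α₀ + 1) ^ 2 := by
      rw [← mul_pow]
      apply pow_le_pow_left₀ (by linarith)
      have : m * (1 / α₀ + 1) = m / α₀ + m := by ring
      rw [this]; linarith
    have h4 : (4 : ℝ) ≤ m ^ 2 * (4 / α₀ ^ 2) := by
      have : m ^ 2 * (4 / α₀ ^ 2) = 4 * (m / α₀) ^ 2 := by ring
      rw [this]; nlinarith
    have hm2 : 4 * (1 + m) ^ 2 + 4 ≤ m ^ 2 * K₂ := by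
      have : m ^ 2 * K₂ = 4 * (m ^ 2 * (1 / α₀ + 1) ^ 2) + m ^ 2 * (4 / α₀ ^ 2) := by
        rw [hK₂]; ring
      rw [this]; linarith [h1m, h4]
    have hSK : m ^ 2 * K₂ ≤ S * K₂ := mul_le_mul_of_nonneg_right hmS hK₂0
    have hKS : 0 ≤ K * S := mul_nonneg hK.le hS0
    calc 2 * normSq (p - 1) + 2 * normSq q
        ≤ 4 * (normSq p + normSq q) + 4 := by linarith [hp1, hq0]
      _ ≤ 4 * (1 + m) ^ 2 + 4 := by linarith [hPQ]
      _ ≤ m ^ 2 * K₂ := hm2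
      _ ≤ S * K₂ := hSK
      _ = K₂ * S := mul_comm _ _
      _ ≤ (K + K₂) * S := by rw [add_mul]; linarith [hKS]

/-- **The orientation hypothesis of Lemma 4.2 cannot be dropped** (our remark; it matters for
the first display in the proof of Proposition 4.3, p. 18, where Lemma 4.2 is quoted without it —
see `simplex_rigidity_sum`): for ANY triple `η` the reflected triple `y_i = η̄_i` is interpolated
by the reflection `F z = z̄`, every edge length is preserved (so for an equilateral unit `η` all
deficits vanish), yet `|F − R|² = 4` for EVERY rotation `R z = r z`, `|r| = 1`. (In the paper's
uses the orientation hypothesis holds by Definition 2.4 (20); see `simplex_rigidity_sum`.)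
[cite: Theil2006, §4.1 Lemma 4.2 and proof of Prop. 4.3, first display (preprint pp. 17–18); our remark] -/
theorem frob_sq_conj_sub_rotation (η : Fin 3 → ℂ) (r : ℂ) (hr : ‖r‖ = 1) :
    (∀ i : Fin 3, Complex.conjAe.toLinearMap (η i - η 0) = conj (η i) - conj (η 0)) ∧
    (∀ i j : Fin 3, ‖conj (η i) - conj (η j)‖ = ‖η i - η j‖) ∧
    ‖(Complex.conjAe.toLinearMap - LinearMap.mulLeft ℝ r) 1‖ ^ 2 +
        ‖(Complex.conjAe.toLinearMap - LinearMap.mulLeft ℝ r) I‖ ^ 2 = 4 := by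
  refine ⟨fun i => ?_, fun i j => ?_, ?_⟩
  · rw [AlgEquiv.toLinearMap_apply, Complex.conjAe_coe, map_sub]
  · rw [← map_sub, Complex.norm_conj]
  · have e : ∀ z, (Complex.conjAe.toLinearMap - LinearMap.mulLeft ℝ r) z =
        (-r) * z + 1 * conj z := by
      intro z
      rw [LinearMap.sub_apply, LinearMap.mulLeft_apply, AlgEquiv.toLinearMap_apply,
        Complex.conjAe_coe]
      ring
    rw [e, e, frob_of_mul_add_mul_conj, normSq_neg, map_one, Complex.normSq_eq_norm_sq, hr]
    norm_num

/-! ### The same on `Plane = EuclideanSpace ℝ (Fin 2)` with `Theil2006.det₂` -/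

section PlaneForm

/-- The identification `ℝ² ≅ ℂ`, `x ↦ x₀ + x₁ i` (Mathlib's `Complex.orthonormalBasisOneI`):
real part. [folklore] -/
private theorem toC_re (x : Plane) : (Complex.orthonormalBasisOneI.repr.symm x).re = x 0 := by
  rw [Complex.orthonormalBasisOneI_repr_symm_apply]; simp

/-- Imaginary part of `x₀ + x₁ i`. [folklore] -/
private theorem toC_im (x : Plane) : (Complex.orthonormalBasisOneI.repr.symm x).im = x 1 := by
  rw [Complex.orthonormalBasisOneI_repr_symm_apply]; simp

/-- `(1, 0) ↦ 1`. [folklore] -/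
private theorem toC_b0 : Complex.orthonormalBasisOneI.repr.symm !₂[1, 0] = 1 := by
  apply Complex.ext
  · rw [toC_re]; simp
  · rw [toC_im]; simp

/-- `(0, 1) ↦ i`. [folklore] -/
private theorem toC_b1 : Complex.orthonormalBasisOneI.repr.symm !₂[0, 1] = I := by
  apply Complex.ext
  · rw [toC_re]; simp
  · rw [toC_im]; simp

/-- The tree's `det₂` is `Re z Im w − Im z Re w` in complex coordinates. [folklore] -/
private theorem det₂_eq_toC (u v : Plane) :
    det₂ u v = (Complex.orthonormalBasisOneI.repr.symm u).re *
        (Complex.orthonormalBasisOneI.repr.symm v).im -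
      (Complex.orthonormalBasisOneI.repr.symm u).im *
        (Complex.orthonormalBasisOneI.repr.symm v).re := by
  rw [toC_re, toC_re, toC_im, toC_im, det₂]

/-- **Theil 2006, Lemma 4.2 on `ℝ² = Plane`** (the statement of `simplex_rigidity` transported
along the isometry `ℂ ≅ ℝ²`, with the tree's `det₂` and rotations as linear isometry
equivalences of determinant `1`; the Frobenius norm through the standard basis
`(1,0), (0,1)`). [cite: Theil2006, §4.1 Lemma 4.2 (50)–(51) (preprint pp. 17–18)] -/
theorem simplex_rigidity_plane :
    ∃ K α₀ : ℝ, 0 < K ∧ 0 < α₀ ∧ ∀ (y η : Fin 3 → Plane) (F : Plane →ₗ[ℝ] Plane),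
      0 ≤ det₂ (y 1 - y 0) (y 2 - y 0) * det₂ (η 1 - η 0) (η 2 - η 0) →
      (∀ i j : Fin 3, i ≠ j → ‖η i - η j‖ = 1) →
      (∀ i : Fin 3, F (η i - η 0) = y i - y 0) →
      ∀ m : ℝ, m ≤ α₀ → (∀ i j : Fin 3, i ≠ j → |‖y i - y j‖ - 1| ≤ m) →
        (∃ R : Plane ≃ₗᵢ[ℝ] Plane, LinearMap.det (R.toLinearEquiv : Plane →ₗ[ℝ] Plane) = 1 ∧
          ‖F !₂[1, 0] - R !₂[1, 0]‖ ^ 2 + ‖F !₂[0, 1] - R !₂[0, 1]‖ ^ 2 ≤ K * m ^ 2) ∧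
        (∃ (G : Plane →ₗ[ℝ] Plane) (R : Plane ≃ₗᵢ[ℝ] Plane), G.comp F = LinearMap.id ∧
          F.comp G = LinearMap.id ∧ LinearMap.det (R.toLinearEquiv : Plane →ₗ[ℝ] Plane) = 1 ∧
          ‖G !₂[1, 0] - R !₂[1, 0]‖ ^ 2 + ‖G !₂[0, 1] - R !₂[0, 1]‖ ^ 2 ≤ K * m ^ 2) := by
  obtain ⟨K, α₀, hK, hα₀, h⟩ := simplex_rigidity
  refine ⟨K, α₀, hK, hα₀, fun y η F hor hη hF m hm hdef => ?_⟩
  set T := Complex.orthonormalBasisOneI.repr with hT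
  -- transported data
  set y' : Fin 3 → ℂ := fun i => T.symm (y i) with hy'
  set η' : Fin 3 → ℂ := fun i => T.symm (η i) with hη'
  set F' : ℂ →ₗ[ℝ] ℂ :=
    (T.symm.toLinearEquiv : Plane →ₗ[ℝ] ℂ) ∘ₗ F ∘ₗ (T.toLinearEquiv : ℂ →ₗ[ℝ] Plane) with hF'
  have hF'app : ∀ z, F' z = T.symm (F (T z)) := fun z => rfl
  have hsub : ∀ i j, y' i - y' j = T.symm (y i - y j) := fun i j => by simp [hy', map_sub]
  have hsubη : ∀ i j, η' i - η' j = T.symm (η i - η j) := fun i j => by simp [hη', map_sub]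
  have hor' : 0 ≤ ((y' 1 - y' 0).re * (y' 2 - y' 0).im - (y' 1 - y' 0).im * (y' 2 - y' 0).re) *
      ((η' 1 - η' 0).re * (η' 2 - η' 0).im - (η' 1 - η' 0).im * (η' 2 - η' 0).re) := by
    rw [hsub, hsub, hsubη, hsubη, ← det₂_eq_toC, ← det₂_eq_toC]; exact hor
  have hη'' : ∀ i j : Fin 3, i ≠ j → ‖η' i - η' j‖ = 1 := fun i j hij => by
    rw [hsubη, LinearIsometryEquiv.norm_map]; exact hη i j hij
  have hF'' : ∀ i : Fin 3, F' (η' i - η' 0) = y' i - y' 0 := fun i => by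
    rw [hsubη, hF'app, LinearIsometryEquiv.apply_symm_apply, hF, hsub]
  have hdef' : ∀ i j : Fin 3, i ≠ j → |‖y' i - y' j‖ - 1| ≤ m := fun i j hij => by
    rw [hsub, LinearIsometryEquiv.norm_map]; exact hdef i j hij
  obtain ⟨⟨r, hr, h50⟩, ⟨G', r', hGF, hFG, hr', h51⟩⟩ := h y' η' F' hor' hη'' hF'' m hm hdef'
  -- rotations transported back
  have rot : ∀ a : ℂ, ‖a‖ = 1 → ∃ R : Plane ≃ₗᵢ[ℝ] Plane,
      LinearMap.det (R.toLinearEquiv : Plane →ₗ[ℝ] Plane) = 1 ∧ ∀ x, R x = T (a * T.symm x) := by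
    intro a ha
    let c : Circle := ⟨a, mem_sphere_zero_iff_norm.2 ha⟩
    refine ⟨(T.symm.trans (rotation c)).trans T, ?_, fun x => by simp [rotation_apply, c]⟩
    have e : ((((T.symm.trans (rotation c)).trans T).toLinearEquiv : Plane →ₗ[ℝ] Plane)) =
        (T.toLinearEquiv : ℂ →ₗ[ℝ] Plane) ∘ₗ ((rotation c).toLinearEquiv : ℂ →ₗ[ℝ] ℂ) ∘ₗ
          ((T.toLinearEquiv).symm : Plane →ₗ[ℝ] ℂ) := by
      apply LinearMap.ext; intro x; rfl
    rw [e, LinearMap.det_conj, det_rotation]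
  have b0 : T.symm !₂[1, 0] = 1 := toC_b0
  have b1 : T.symm !₂[0, 1] = I := toC_b1
  have Tb0 : T 1 = !₂[1, 0] := by rw [← b0, LinearIsometryEquiv.apply_symm_apply]
  have Tb1 : T I = !₂[0, 1] := by rw [← b1, LinearIsometryEquiv.apply_symm_apply]
  constructor
  · obtain ⟨R, hRdet, hR⟩ := rot r hr
    refine ⟨R, hRdet, ?_⟩
    have e1 : F !₂[1, 0] - R !₂[1, 0] = T ((F' - LinearMap.mulLeft ℝ r) 1) := by
      rw [LinearMap.sub_apply, LinearMap.mulLeft_apply, hF'app, hR, b0, Tb0, map_sub,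
        LinearIsometryEquiv.apply_symm_apply, mul_one]
    have e2 : F !₂[0, 1] - R !₂[0, 1] = T ((F' - LinearMap.mulLeft ℝ r) I) := by
      rw [LinearMap.sub_apply, LinearMap.mulLeft_apply, hF'app, hR, b1, Tb1, map_sub,
        LinearIsometryEquiv.apply_symm_apply]
    rw [e1, e2, LinearIsometryEquiv.norm_map, LinearIsometryEquiv.norm_map]
    exact h50
  · obtain ⟨R, hRdet, hR⟩ := rot r' hr'
    let G : Plane →ₗ[ℝ] Plane :=
      (T.toLinearEquiv : ℂ →ₗ[ℝ] Plane) ∘ₗ G' ∘ₗ (T.symm.toLinearEquiv : Plane →ₗ[ℝ] ℂ)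
    have hGapp : ∀ x, G x = T (G' (T.symm x)) := fun x => rfl
    refine ⟨G, R, ?_, ?_, hRdet, ?_⟩
    · apply LinearMap.ext; intro x
      rw [LinearMap.comp_apply, LinearMap.id_apply, hGapp]
      have : T.symm (F x) = F' (T.symm x) := by rw [hF'app, LinearIsometryEquiv.apply_symm_apply]
      rw [this, ← LinearMap.comp_apply, hGF, LinearMap.id_apply, LinearIsometryEquiv.apply_symm_apply]
    · apply LinearMap.ext; intro x
      rw [LinearMap.comp_apply, LinearMap.id_apply, hGapp]
      have : F (T (G' (T.symm x))) = T (F' (G' (T.symm x))) := by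
        rw [hF'app, LinearIsometryEquiv.apply_symm_apply]
      rw [this, ← LinearMap.comp_apply, hFG, LinearMap.id_apply, LinearIsometryEquiv.apply_symm_apply]
    · have e1 : G !₂[1, 0] - R !₂[1, 0] = T ((G' - LinearMap.mulLeft ℝ r') 1) := by
        rw [LinearMap.sub_apply, LinearMap.mulLeft_apply, hGapp, hR, b0, map_sub, mul_one]
      have e2 : G !₂[0, 1] - R !₂[0, 1] = T ((G' - LinearMap.mulLeft ℝ r') I) := by
        rw [LinearMap.sub_apply, LinearMap.mulLeft_apply, hGapp, hR, b1, map_sub]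
      rw [e1, e2, LinearIsometryEquiv.norm_map, LinearIsometryEquiv.norm_map]
      exact h51

/-- **Proof of Proposition 4.3, first display, on `ℝ² = Plane`**: `simplex_rigidity_sum`
transported along `ℂ ≅ ℝ²` (the tree's `det₂`; rotations `R : Plane ≃ₗᵢ[ℝ] Plane` with
`LinearMap.det R = 1`; Frobenius norm through `(1,0), (0,1)`); the same two print flags apply.
[cite: Theil2006, §4.1 proof of Prop. 4.3, first display (preprint p. 18), from Lemma 4.2 (50)] -/
theorem simplex_rigidity_sum_plane :
    ∃ K : ℝ, 0 < K ∧ ∀ (y η : Fin 3 → Plane) (F : Plane →ₗ[ℝ] Plane),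
      0 ≤ det₂ (y 1 - y 0) (y 2 - y 0) * det₂ (η 1 - η 0) (η 2 - η 0) →
      (∀ i j : Fin 3, i ≠ j → ‖η i - η j‖ = 1) →
      (∀ i : Fin 3, F (η i - η 0) = y i - y 0) →
      ∃ R : Plane ≃ₗᵢ[ℝ] Plane, LinearMap.det (R.toLinearEquiv : Plane →ₗ[ℝ] Plane) = 1 ∧
        ‖F !₂[1, 0] - R !₂[1, 0]‖ ^ 2 + ‖F !₂[0, 1] - R !₂[0, 1]‖ ^ 2 ≤
          K * ((‖y 1 - y 0‖ - 1) ^ 2 + (‖y 2 - y 0‖ - 1) ^ 2 + (‖y 2 - y 1‖ - 1) ^ 2) := by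
  obtain ⟨K, hK, h⟩ := simplex_rigidity_sum
  refine ⟨K, hK, fun y η F hor hη hF => ?_⟩
  set T := Complex.orthonormalBasisOneI.repr with hT
  set y' : Fin 3 → ℂ := fun i => T.symm (y i) with hy'
  set η' : Fin 3 → ℂ := fun i => T.symm (η i) with hη'
  set F' : ℂ →ₗ[ℝ] ℂ :=
    (T.symm.toLinearEquiv : Plane →ₗ[ℝ] ℂ) ∘ₗ F ∘ₗ (T.toLinearEquiv : ℂ →ₗ[ℝ] Plane) with hF'
  have hF'app : ∀ z, F' z = T.symm (F (T z)) := fun z => rfl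
  have hsub : ∀ i j, y' i - y' j = T.symm (y i - y j) := fun i j => by simp [hy', map_sub]
  have hsubη : ∀ i j, η' i - η' j = T.symm (η i - η j) := fun i j => by simp [hη', map_sub]
  have hor' : 0 ≤ ((y' 1 - y' 0).re * (y' 2 - y' 0).im - (y' 1 - y' 0).im * (y' 2 - y' 0).re) *
      ((η' 1 - η' 0).re * (η' 2 - η' 0).im - (η' 1 - η' 0).im * (η' 2 - η' 0).re) := by
    rw [hsub, hsub, hsubη, hsubη, ← det₂_eq_toC, ← det₂_eq_toC]; exact hor
  have hη'' : ∀ i j : Fin 3, i ≠ j → ‖η' i - η' j‖ = 1 := fun i j hij => by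
    rw [hsubη, LinearIsometryEquiv.norm_map]; exact hη i j hij
  have hF'' : ∀ i : Fin 3, F' (η' i - η' 0) = y' i - y' 0 := fun i => by
    rw [hsubη, hF'app, LinearIsometryEquiv.apply_symm_apply, hF, hsub]
  have hnorm : ∀ i j, ‖y' i - y' j‖ = ‖y i - y j‖ := fun i j => by
    rw [hsub, LinearIsometryEquiv.norm_map]
  obtain ⟨r, hr, h50⟩ := h y' η' F' hor' hη'' hF''
  rw [hnorm, hnorm, hnorm] at h50
  -- the rotation `z ↦ r z` transported back, as in `simplex_rigidity_plane`
  let c : Circle := ⟨r, mem_sphere_zero_iff_norm.2 hr⟩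
  have hdet : LinearMap.det
      (((T.symm.trans (rotation c)).trans T).toLinearEquiv : Plane →ₗ[ℝ] Plane) = 1 := by
    have e : ((((T.symm.trans (rotation c)).trans T).toLinearEquiv : Plane →ₗ[ℝ] Plane)) =
        (T.toLinearEquiv : ℂ →ₗ[ℝ] Plane) ∘ₗ ((rotation c).toLinearEquiv : ℂ →ₗ[ℝ] ℂ) ∘ₗ
          ((T.toLinearEquiv).symm : Plane →ₗ[ℝ] ℂ) := by
      apply LinearMap.ext; intro x; rfl
    rw [e, LinearMap.det_conj, det_rotation]
  have hR : ∀ x, ((T.symm.trans (rotation c)).trans T) x = T (r * T.symm x) := fun x => by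
    simp [rotation_apply, c]
  refine ⟨(T.symm.trans (rotation c)).trans T, hdet, ?_⟩
  have b0 : T.symm !₂[1, 0] = 1 := toC_b0
  have b1 : T.symm !₂[0, 1] = I := toC_b1
  have Tb0 : T 1 = !₂[1, 0] := by rw [← b0, LinearIsometryEquiv.apply_symm_apply]
  have Tb1 : T I = !₂[0, 1] := by rw [← b1, LinearIsometryEquiv.apply_symm_apply]
  have e1 : F !₂[1, 0] - ((T.symm.trans (rotation c)).trans T) !₂[1, 0] =
      T ((F' - LinearMap.mulLeft ℝ r) 1) := by
    rw [LinearMap.sub_apply, LinearMap.mulLeft_apply, hF'app, hR, b0, Tb0, map_sub,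
      LinearIsometryEquiv.apply_symm_apply, mul_one]
  have e2 : F !₂[0, 1] - ((T.symm.trans (rotation c)).trans T) !₂[0, 1] =
      T ((F' - LinearMap.mulLeft ℝ r) I) := by
    rw [LinearMap.sub_apply, LinearMap.mulLeft_apply, hF'app, hR, b1, Tb1, map_sub,
      LinearIsometryEquiv.apply_symm_apply]
  rw [e1, e2, LinearIsometryEquiv.norm_map, LinearIsometryEquiv.norm_map]
  exact h50

end PlaneForm

/-! ## Lemma 4.2 as a bi-Lipschitz estimate for the affine gradient (the form used on p. 23) -/

section BiLipschitz

/-- `‖v‖² = v₀² + v₁²` on `ℝ²`. [folklore] -/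
private theorem norm_sq_coords₂ (v : Plane) : ‖v‖ ^ 2 = v 0 ^ 2 + v 1 ^ 2 := by
  rw [EuclideanSpace.norm_sq_eq, Fin.sum_univ_two, Real.norm_eq_abs, Real.norm_eq_abs, sq_abs,
    sq_abs]

/-- Expansion in the standard basis of `ℝ²`. [folklore] -/
private theorem eq_smul_basis (w : Plane) : w = w 0 • !₂[1, 0] + w 1 • !₂[0, 1] := by
  ext i
  fin_cases i <;> simp

/-- From the Frobenius bound `‖(F − R)e₁‖² + ‖(F − R)e₂‖² ≤ K m²` to the operator bound
`‖F w − R w‖ ≤ √K · m · ‖w‖`. [folklore] -/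
private theorem norm_sub_le_of_frob {F : Plane →ₗ[ℝ] Plane} {R : Plane ≃ₗᵢ[ℝ] Plane} {K m : ℝ}
    (hK : 0 ≤ K) (hm : 0 ≤ m)
    (h : ‖F !₂[1, 0] - R !₂[1, 0]‖ ^ 2 + ‖F !₂[0, 1] - R !₂[0, 1]‖ ^ 2 ≤ K * m ^ 2) (w : Plane) :
    ‖F w - R w‖ ≤ Real.sqrt K * m * ‖w‖ := by
  set a := ‖F !₂[1, 0] - R !₂[1, 0]‖ with ha
  set b := ‖F !₂[0, 1] - R !₂[0, 1]‖ with hb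
  have ha0 : 0 ≤ a := norm_nonneg _
  have hb0 : 0 ≤ b := norm_nonneg _
  have hexp : F w - R w = w 0 • (F !₂[1, 0] - R !₂[1, 0]) + w 1 • (F !₂[0, 1] - R !₂[0, 1]) := by
    conv_lhs => rw [eq_smul_basis w]
    simp only [map_add, map_smul, smul_sub]
    abel
  have h1 : ‖F w - R w‖ ≤ |w 0| * a + |w 1| * b := by
    rw [hexp]
    refine (norm_add_le _ _).trans ?_
    rw [norm_smul, norm_smul, Real.norm_eq_abs, Real.norm_eq_abs]
  -- Cauchy–Schwarz in `ℝ²`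
  have hw : ‖w‖ ^ 2 = w 0 ^ 2 + w 1 ^ 2 := norm_sq_coords₂ w
  have h2 : (|w 0| * a + |w 1| * b) ^ 2 ≤ (w 0 ^ 2 + w 1 ^ 2) * (a ^ 2 + b ^ 2) := by
    rw [← sq_abs (w 0), ← sq_abs (w 1)]
    nlinarith [sq_nonneg (|w 0| * b - |w 1| * a), abs_nonneg (w 0), abs_nonneg (w 1)]
  have h3 : (w 0 ^ 2 + w 1 ^ 2) * (a ^ 2 + b ^ 2) ≤ (Real.sqrt K * m * ‖w‖) ^ 2 := by
    rw [← hw, mul_pow, mul_pow, Real.sq_sqrt hK]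
    have := mul_le_mul_of_nonneg_left h (sq_nonneg ‖w‖)
    linarith
  have h4 : 0 ≤ Real.sqrt K * m * ‖w‖ := by positivity
  have h5 : (|w 0| * a + |w 1| * b) ^ 2 ≤ (Real.sqrt K * m * ‖w‖) ^ 2 := h2.trans h3
  exact h1.trans (abs_le_of_sq_le_sq' h5 h4).2

/-- **Lemma 4.2 as a Lipschitz estimate** — the form in which it is used for the interpolation
`u` on p. 23 ("Clearly `u ∈ W^{1,∞}(Ω₂)` and by Lemma 4.2 `‖∇u − SO(2)‖_{L∞(Ω₂)} ≤ Kα`"): under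
the hypotheses of Lemma 4.2 (a triangle `y` with `||y_i − y_j| − 1| ≤ m ≤ α₀`, a unit lattice
triangle `η` with the same orientation, `F` the affine gradient with `F(η_i − η₀) = y_i − y₀`), the
gradient is uniformly `(1 ± K m)`-bi-Lipschitz: `(1 − K m)|w| ≤ |F w| ≤ (1 + K m)|w|` for all
`w ∈ ℝ²` (with `K = √K₄.₂`). [cite: Theil2006, §4.1 Lemma 4.2 (50) (preprint p. 17); §4.2 proof
of Proposition 4.8 (61) (p. 23)] -/
theorem simplex_bilipschitz_plane :
    ∃ K α₀ : ℝ, 0 < K ∧ 0 < α₀ ∧ ∀ (y η : Fin 3 → Plane) (F : Plane →ₗ[ℝ] Plane),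
      0 ≤ det₂ (y 1 - y 0) (y 2 - y 0) * det₂ (η 1 - η 0) (η 2 - η 0) →
      (∀ i j : Fin 3, i ≠ j → ‖η i - η j‖ = 1) →
      (∀ i : Fin 3, F (η i - η 0) = y i - y 0) →
      ∀ m : ℝ, m ≤ α₀ → (∀ i j : Fin 3, i ≠ j → |‖y i - y j‖ - 1| ≤ m) →
        ∀ w : Plane, (1 - K * m) * ‖w‖ ≤ ‖F w‖ ∧ ‖F w‖ ≤ (1 + K * m) * ‖w‖ := by
  obtain ⟨K, α₀, hK, hα₀, h⟩ := simplex_rigidity_plane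
  refine ⟨Real.sqrt K, α₀, Real.sqrt_pos.2 hK, hα₀, fun y η F hor hη hF m hm hdef w => ?_⟩
  have hm0 : 0 ≤ m := (abs_nonneg _).trans (hdef 0 1 (by decide))
  obtain ⟨⟨R, -, h50⟩, -⟩ := h y η F hor hη hF m hm hdef
  have hd := norm_sub_le_of_frob hK.le hm0 h50 w
  have hR : ‖R w‖ = ‖w‖ := R.norm_map w
  constructor
  · have := norm_sub_norm_le (R w) (F w)
    have h' : ‖R w - F w‖ ≤ Real.sqrt K * m * ‖w‖ := by rwa [norm_sub_rev]
    nlinarith [hR]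
  · have := norm_le_norm_add_norm_sub' (F w) (R w)
    have h' : ‖F w‖ ≤ ‖R w‖ + ‖F w - R w‖ := by
      calc ‖F w‖ = ‖R w + (F w - R w)‖ := by rw [add_sub_cancel]
        _ ≤ ‖R w‖ + ‖F w - R w‖ := norm_add_le _ _
    nlinarith [hR]

end BiLipschitz

end Theil2006

end Literature.MathematicalPhysics.StatisticalMechanics

end
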